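/-
Copyright (c) 2026 the pub-hodgecm-mathlib formalisation cell (harness21).  Prover seat hodgecm-mathlib-K2Liu-p07 (g3), Track B «K2-LIT»,
#184♮ = hLiu418 = `stmt-HodgeConjecture-24832`; #42S payer road, organ S1 (local Siegel–Weil spanning), ROAD W file F7r
(LEAD F0P6-plan (g14) RULING «M-158a» (4)∕ADDENDUM (3)∕«M-158c»; organ lead's DESIGN-W3-v2 §2; referee K2Liu-ref1 (g5) AUDIT-AW2 «SIGN (M4)», R1–R3;
census K2Liu-p07 (g3) on `K2/STATUS.md`).
-/
import Summits.HodgeConjecture.HodgeConjecture.Theorems.K2LiuLocalSWSimilitudeSections      -- ★ F5′-C1: `Ad(d_a)` word laws, `detDelta_leviOfWeyl`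
import Literature.NumberTheory.K2Lit.LocalSiegelIntertwining                                -- ★ `unipDeltaLocal`, `mem_unipDeltaLocal_iff_blocks`
import HarnessLib

/-!
# Crux `HLiu418`, #42S organ S1, ROAD W, file F7r: THE RAMIFIED WITNESS — TWO SIEGEL–WEIL SPACES FROM ONE SECTION AND THE
# SIMILITUDE `d_a`; THE RELATIVE SIGN IS `χ_w(a⁻¹) = ε_w(a) = −1`

Cell `hodgecm-mathlib`, crux item hLiu418 = `stmt-HodgeConjecture-24832`; squad K2 ∕ K2Liu; LEAD F0P6-plan (g14), organ lead K2Liu-p06 (g4);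
prover K2Liu-p07 (g3).  THEOREMS ONLY (no `def`, no instance, no notation, no named-fact hypothesis, no `sorry`); lane
`--supports stmt-HodgeConjecture-24832 --as helper`.

WHY.  ROAD W proves the local Siegel–Weil spanning `I_v(½, χ_v) ≤ R_v(V′⁺) + R_v(V′⁻)` through ONE witness `f₀ ∈ R(V′⁺) + R(V′⁻)` plugged
into the socket ★ F3d `K2LiuLocalSWSpanningOfWitness.localDegPS_le_of_witness` (binders `hf₀`, `hf₀off`, `hf₀inv`, `hf₀out`, `hsum`; organ lead's
`SPEC-S1-AssemblySocket`).  At a RAMIFIED non-split place no lattice count separates the two hermitian spaces (referee's unit lemma `T_d = T_{ud}`,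
`COUNT-F7r` §2: `T⁺ ≡ T⁻`); the separating input is ONE sign.  In the similitude currency of F5′ (★ `K2LiuLocalSWSimilitudeTensor`: `R(V′⁻_v) =
D_a R(V′⁺_v)`, `D_a f = f ∘ Ad(d_a)`, `a ∈ 𝒪_vˣ` a unit NON-norm) the witness is built from ONE section `F ∈ R(V′⁺_v)`:
  `f₀ := F + μ · (F ∘ Ad(d_a))`, `μ := −κ₁⁻¹`,
and everything reduces to single-space facts about `F` plus the ★ F5′-C1 word laws:
* off the big cell `Ω = P_Δ w_Δ N_Δ`, GIVEN the eigen-relation (H-mid) `F(Ad_{d_a} g) = κ₁ F(g)` (`g ∉ Ω`; referee's R2, file F6c), `f₀ = (1 + μκ₁) F = 0`;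
* `Ad(d_a)` PERMUTES the finite coordinate quotient `N₁ ⧸ N₀` (`Ad n(t) = n(a⁻¹t)`, `a` a unit, the boxes `𝒪`-stable), so with the word law
  `(F ∘ Ad d_a)(w_Δ u) = κ₂ F(w_Δ Ad(d_a) u)` (`κ₂ = χ_s(ℓ_a)`, ★ `comp_localCongr_dA_apply_weylDelta_mul`):
  `Σ_{q ∈ N₁⧸N₀} f₀(w_Δ q̃) = (1 + μκ₂) · Σ_q F(w_Δ q̃)`;
* THE SIGN: `κ₂ = κ₁²` (`det_Δ ℓ_a = a⁻²`, `det_Δ ℓ₁ = a⁻¹`, `n = 2`) so `1 + μκ₂ = 1 − κ₁`, and for Kudla's CM datum (`χ_w|_{F_vˣ} = ε_w`, ★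
  `isEpsilonChar_localComponent_inv`) `κ₁ = χ_w(a⁻¹) = (δ², a)_v = −1`: **`Σ_q f₀(w_Δ q̃) = 2 · Σ_q F(w_Δ q̃)`** — non-zero as soon as the ONE-space
  big-cell sum is (soft at ramified places: an open non-empty set has positive volume).
NO Weil-index value, no `c₂ = c₁c₁′` functional identity, no lattice table enters (referee AUDIT-AW2 «SIGN (M4)»; LEAD ADDENDUM (3)).

CONTENTS (generic quadratic `E/F`, `c`, place `v`, `U(J_D)(F_v)` for `JD = (gramD T₀).map`):
* §1 `sum_quotient_out_comp_eq` — re-indexing `Σ_{q : N₁ ⧸ N₀} g(θ q̃) = Σ_q g(q̃)` for an endomorphism `θ` with `θ N₀ = N₀`, `θ N₁ ⊆ N₁`, `g` right-`N₀`-invariant.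
* §2 WITNESS CALCULUS BY VALUE for `f₀ = F + μ · F ∘ θ` (abstract `θ`, scalars `κ₁ κ₂ μ`): the five socket binders of `f₀` from those of `F`
  (`siegel_add_mul_comp`, `offBigCell_add_mul_comp`, `rightInvariant_add_mul_comp`, `weylDelta_out_add_mul_comp`, `sum_weylDelta_add_mul_comp`,
  `sum_weylDelta_add_mul_comp_of_sq`).
* §3 `θ = Ad(d_a)` (letters `hD₀ hDA hb hDAJ` of ★ F5′-A1): `N_Δ` and the coordinate subgroups are `Ad(d_a)`-stable (`localCongr_dA_mem_unipDeltaLocal_iff`,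
  `blkB_matA_localCongr_dA`, `localCongr_dA_mem_coordinate_iff`), `χ_s(ℓ_a) = χ_s(ℓ₁)^n` (`localSiegelCharacter_leviOfWeyl_eq_pow`), head
  `sum_weylDelta_witness_localCongr_dA`.
* The CM numbers (`χ_s(ℓ₁) = −1`, the doubling `Σ_q f₀(w_Δ q̃) = 2·Σ_q F(w_Δ q̃)`) are the sequel ★ `K2LiuLocalSWRamifiedRelativeSignCM`.
References: [Kudla1994] §3; [HarrisKudlaSweet1996] §1 (1.5), (1.11), (1.15); [KudlaSweet1997] §1; [BernsteinZelevinsky1976] §1.5; [Casselman1980] §3.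
HONEST LABEL.  Count-neutral helper: `HC_CM` is proved only modulo the 7 printed citations (2 remaining named inputs: hLiu418 = `stmt-HodgeConjecture-24832`,
h413 = `stmt-HodgeConjecture-24833`) until rung 0 closes.
-/

set_option autoImplicit false
set_option linter.dupNamespace false -- the mandated namespace repeats `HodgeConjecture.HodgeConjecture`

noncomputable section

open scoped Matrix
open NumberField IsDedekindDomain Matrix
open Literature.NumberTheory.Automorphic Literature.NumberTheory.Automorphic.UnitaryGroup
open Literature.NumberTheory.GelbartRogawski1991.AdaptedBlocks
open Literature.NumberTheory.GelbartRogawski1991.UnitaryDualPair.LocalSplitting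
open Literature.NumberTheory.K2Lit.LocalSiegelDoubled
open Summit.HodgeConjecture.HodgeConjecture.Cruxes.HLiu418.K2LiuLocalSWSimilitudeAlgebra
open Summit.HodgeConjecture.HodgeConjecture.Cruxes.HLiu418.K2LiuLocalSWSimilitudeSections

namespace Summit.HodgeConjecture.HodgeConjecture.Cruxes.HLiu418.K2LiuLocalSWRamifiedRelativeSign

/-! ## §1 Re-indexing a sum over `N₁ ⧸ N₀` along an endomorphism permuting the cosets -/

section Reindex

variable {G : Type*} [Group G]

/-- **`Σ_{q ∈ N₁⧸N₀} g(θ q̃) = Σ_{q ∈ N₁⧸N₀} g(q̃)`** for an endomorphism `θ` with `θ⁻¹ N₀ = N₀` (on `N₁`) and `θ N₁ ⊆ N₁`, and `g` right-`N₀`-invariant: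
`θ` induces an injection — hence a permutation — of the finite set `N₁ ⧸ N₀`, and `g` does not see the choice of representatives.
[cite: BernsteinZelevinsky1976, §1.5] [cite: KudlaSweet1997, §1] -/
theorem sum_quotient_out_comp_eq (θ : G →* G) {N₀ N₁ : Subgroup G} (h₀ : ∀ u ∈ N₁, (θ u ∈ N₀ ↔ u ∈ N₀)) (h₁ : ∀ u ∈ N₁, θ u ∈ N₁)
    [Fintype (N₁ ⧸ N₀.subgroupOf N₁)] {M : Type*} [AddCommMonoid M] (g : G → M) (hg : ∀ x, ∀ u ∈ N₀, g (x * u) = g x) :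
    ∑ q : N₁ ⧸ N₀.subgroupOf N₁, g (θ (q.out : G)) = ∑ q : N₁ ⧸ N₀.subgroupOf N₁, g (q.out : G) := by
  classical
  set e : N₁ → N₁ := fun x => ⟨θ x, h₁ x x.2⟩ with he
  have hrel : ∀ a b : N₁, QuotientGroup.leftRel (N₀.subgroupOf N₁) a b ↔ ((a : G)⁻¹ * b) ∈ N₀ := fun a b => by
    rw [QuotientGroup.leftRel_apply, Subgroup.mem_subgroupOf, Subgroup.coe_mul, Subgroup.coe_inv]
  have hcompat : ∀ a b : N₁, QuotientGroup.leftRel (N₀.subgroupOf N₁) a b → QuotientGroup.leftRel (N₀.subgroupOf N₁) (e a) (e b) := by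
    intro a b hab
    rw [hrel] at hab ⊢
    have hmem : ((a : G)⁻¹ * b) ∈ N₁ := N₁.mul_mem (N₁.inv_mem a.2) b.2
    have : θ ((a : G)⁻¹ * b) ∈ N₀ := (h₀ _ hmem).2 hab
    simpa [he, map_mul, map_inv] using this
  set σ : N₁ ⧸ N₀.subgroupOf N₁ → N₁ ⧸ N₀.subgroupOf N₁ := Quotient.map' e hcompat with hσ
  have hσmk : ∀ x : N₁, σ (QuotientGroup.mk x) = QuotientGroup.mk (e x) := fun x => rfl
  have hσinj : Function.Injective σ := by
    intro p q hpq
    induction p using QuotientGroup.induction_on with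
    | H a =>
      induction q using QuotientGroup.induction_on with
      | H b =>
        rw [hσmk, hσmk, QuotientGroup.eq, Subgroup.mem_subgroupOf] at hpq
        rw [QuotientGroup.eq, Subgroup.mem_subgroupOf]
        have hmem : ((a : G)⁻¹ * b) ∈ N₁ := N₁.mul_mem (N₁.inv_mem a.2) b.2
        have hθ : θ ((a : G)⁻¹ * b) ∈ N₀ := by simpa [he, map_mul, map_inv] using hpq
        simpa using (h₀ _ hmem).1 hθ
  have hσbij : Function.Bijective σ := Finite.injective_iff_bijective.1 hσinj
  refine Fintype.sum_bijective σ hσbij (fun q => g (θ (q.out : G))) (fun q => g (q.out : G)) fun q => ?_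
  obtain ⟨h, H⟩ := QuotientGroup.mk_out_eq_mul (N₀.subgroupOf N₁) (e q.out)
  have hq : σ q = QuotientGroup.mk (e q.out) := by
    conv_lhs => rw [← QuotientGroup.out_eq' q]
    exact hσmk _
  rw [hq, H, Subgroup.coe_mul]
  exact (hg _ _ (Subgroup.mem_subgroupOf.1 h.2)).symm

end Reindex

/-! ## §2 The witness calculus, by value: `f₀ = F + μ · (F ∘ θ)` -/

section Witness

variable (F : Type) [Field F] [NumberField F] (E : Type) [Field E] [NumberField E] [Algebra F E] [Algebra.IsQuadraticExtension F E]
  (c : E ≃ₐ[F] E) {δ : E} (hcδ : c δ = -δ) (hδ : δ ≠ 0) {d : F} (hd : δ * δ = algebraMap F E d)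
  (v : HeightOneSpectrum (𝓞 F)) (n : ℕ) {T₀ : Matrix (Fin n) (Fin n) F} (hT₀ : T₀.IsSymm)
  {JD : Matrix (Fin (n + n)) (Fin (n + n)) E} (hJD : JD = (gramD F n T₀).map (algebraMap F E))
  (θ : UnitaryGroup.localPi E c (n + n) JD v →* UnitaryGroup.localPi E c (n + n) JD v)
  (F₀ : UnitaryGroup.localPi E c (n + n) JD v → ℂ) (μ : ℂ)

/-- **`hf₀` for `f₀ = F + μ·(F ∘ θ)`**: if `F(p h) = χ(p) F(h)` on `P_Δ` and `θ` preserves `P_Δ` and `χ`, then `f₀(p h) = χ(p) f₀(h)`.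
[cite: HarrisKudlaSweet1996, §1 (1.15)] -/
theorem siegel_add_mul_comp {χ : UnitaryGroup.localPi E c (n + n) JD v → ℂ}
    (hF : ∀ p, IsSiegelDelta F E c hcδ hδ hd v n hT₀ hJD p → ∀ h, F₀ (p * h) = χ p * F₀ h)
    (hθP : ∀ p, IsSiegelDelta F E c hcδ hδ hd v n hT₀ hJD p → IsSiegelDelta F E c hcδ hδ hd v n hT₀ hJD (θ p))
    (hχθ : ∀ p, IsSiegelDelta F E c hcδ hδ hd v n hT₀ hJD p → χ (θ p) = χ p)
    (p : UnitaryGroup.localPi E c (n + n) JD v) (hp : IsSiegelDelta F E c hcδ hδ hd v n hT₀ hJD p) (h : UnitaryGroup.localPi E c (n + n) JD v) :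
    (fun x => F₀ x + μ * F₀ (θ x)) (p * h) = χ p * (fun x => F₀ x + μ * F₀ (θ x)) h := by
  simp only [map_mul]
  rw [hF p hp h, hF (θ p) (hθP p hp) (θ h), hχθ p hp]
  ring

/-- **`hf₀off` for `f₀ = F + μ·(F ∘ θ)` from the OFF-BIG-CELL EIGEN-RELATION (H-mid)**: if `F(θ g) = κ₁ F(g)` for every `g ∉ P_Δ w_Δ N_Δ` and `μκ₁ = −1`,
then `f₀ = 0` off the big cell. [cite: Kudla1994, §3] [cite: KudlaSweet1997, §1] -/
theorem offBigCell_add_mul_comp {κ₁ : ℂ} (hμ : μ * κ₁ = -1)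
    (hmid : ∀ g : UnitaryGroup.localPi E c (n + n) JD v,
      (¬ ∃ p, IsSiegelDelta F E c hcδ hδ hd v n hT₀ hJD p ∧ ∃ u ∈ unipDeltaLocal F E c v n (JD := JD), g = p * weylDelta F E c v n hJD * u) →
      F₀ (θ g) = κ₁ * F₀ g)
    (g : UnitaryGroup.localPi E c (n + n) JD v)
    (hg : ¬ ∃ p, IsSiegelDelta F E c hcδ hδ hd v n hT₀ hJD p ∧ ∃ u ∈ unipDeltaLocal F E c v n (JD := JD), g = p * weylDelta F E c v n hJD * u) :
    (fun x => F₀ x + μ * F₀ (θ x)) g = 0 := by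
  simp only
  rw [hmid g hg, ← mul_assoc, hμ]
  ring

omit [Algebra.IsQuadraticExtension F E] in
/-- **`hf₀inv` for `f₀ = F + μ·(F ∘ θ)`**: right-`N₀`-invariance transports when `θ N₀ ⊆ N₀`. [cite: KudlaSweet1997, §1] -/
theorem rightInvariant_add_mul_comp {N₀ : Subgroup (UnitaryGroup.localPi E c (n + n) JD v)}
    (hFinv : ∀ h, ∀ u ∈ N₀, F₀ (h * u) = F₀ h) (h₀ : ∀ u ∈ N₀, θ u ∈ N₀)
    (h : UnitaryGroup.localPi E c (n + n) JD v) (u : UnitaryGroup.localPi E c (n + n) JD v) (hu : u ∈ N₀) :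
    (fun x => F₀ x + μ * F₀ (θ x)) (h * u) = (fun x => F₀ x + μ * F₀ (θ x)) h := by
  simp only [map_mul]
  rw [hFinv h u hu, hFinv (θ h) (θ u) (h₀ u hu)]

omit [Algebra.IsQuadraticExtension F E] in
/-- **`hf₀out` for `f₀ = F + μ·(F ∘ θ)`**: if `F(w_Δ u) = 0` for `u ∈ N_Δ ∖ N₁`, the word law `F(θ(w_Δ u)) = κ₂ F(w_Δ θu)` holds, `θ N_Δ ⊆ N_Δ`, and
`θ⁻¹ N₁ ⊆ N₁` on `N_Δ`, then `f₀(w_Δ u) = 0` for `u ∈ N_Δ ∖ N₁`. [cite: Kudla1994, §3] [cite: KudlaSweet1997, §1] -/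
theorem weylDelta_out_add_mul_comp {κ₂ : ℂ} {N₁ : Subgroup (UnitaryGroup.localPi E c (n + n) JD v)}
    (hFout : ∀ u ∈ unipDeltaLocal F E c v n (JD := JD), u ∉ N₁ → F₀ (weylDelta F E c v n hJD * u) = 0)
    (hword : ∀ u, F₀ (θ (weylDelta F E c v n hJD * u)) = κ₂ * F₀ (weylDelta F E c v n hJD * θ u))
    (hN : ∀ u ∈ unipDeltaLocal F E c v n (JD := JD), θ u ∈ unipDeltaLocal F E c v n (JD := JD))
    (h₁ : ∀ u ∈ unipDeltaLocal F E c v n (JD := JD), θ u ∈ N₁ → u ∈ N₁)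
    (u : UnitaryGroup.localPi E c (n + n) JD v) (hu : u ∈ unipDeltaLocal F E c v n (JD := JD)) (hu₁ : u ∉ N₁) :
    (fun x => F₀ x + μ * F₀ (θ x)) (weylDelta F E c v n hJD * u) = 0 := by
  simp only
  rw [hFout u hu hu₁, hword u, hFout (θ u) (hN u hu) (fun h' => hu₁ (h₁ u hu h')), mul_zero, mul_zero, add_zero]

omit [Algebra.IsQuadraticExtension F E] in
/-- **THE BIG-CELL SUM OF `f₀ = F + μ·(F ∘ θ)`**: with the word law `F(θ(w_Δ u)) = κ₂ F(w_Δ θu)`, `θ` permuting `N₁ ⧸ N₀` and `F` right-`N₀`-invariant,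
`Σ_{q ∈ N₁⧸N₀} f₀(w_Δ q̃) = (1 + μκ₂) · Σ_q F(w_Δ q̃)`. [cite: Kudla1994, §3] [cite: KudlaSweet1997, §1] -/
theorem sum_weylDelta_add_mul_comp {κ₂ : ℂ} {N₀ N₁ : Subgroup (UnitaryGroup.localPi E c (n + n) JD v)} [Fintype (N₁ ⧸ N₀.subgroupOf N₁)]
    (hFinv : ∀ h, ∀ u ∈ N₀, F₀ (h * u) = F₀ h)
    (hword : ∀ u, F₀ (θ (weylDelta F E c v n hJD * u)) = κ₂ * F₀ (weylDelta F E c v n hJD * θ u))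
    (h₀ : ∀ u ∈ N₁, (θ u ∈ N₀ ↔ u ∈ N₀)) (h₁ : ∀ u ∈ N₁, θ u ∈ N₁) :
    ∑ q : N₁ ⧸ N₀.subgroupOf N₁, (fun x => F₀ x + μ * F₀ (θ x)) (weylDelta F E c v n hJD * (q.out : UnitaryGroup.localPi E c (n + n) JD v)) =
      (1 + μ * κ₂) * ∑ q : N₁ ⧸ N₀.subgroupOf N₁, F₀ (weylDelta F E c v n hJD * (q.out : UnitaryGroup.localPi E c (n + n) JD v)) := by
  simp only [hword]
  have hre := sum_quotient_out_comp_eq θ h₀ h₁ (fun u => F₀ (weylDelta F E c v n hJD * u)) fun x u hu => by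
    rw [← mul_assoc]; exact hFinv _ u hu
  rw [Finset.sum_add_distrib, ← Finset.mul_sum, ← Finset.mul_sum, hre]
  ring

omit [Algebra.IsQuadraticExtension F E] in
/-- **… WITH THE RANK RELATION `κ₂ = κ₁²` AND `μκ₁ = −1`**: `Σ_q f₀(w_Δ q̃) = (1 − κ₁) · Σ_q F(w_Δ q̃)`; non-zero when `κ₁ ≠ 1` and the one-space sum is.
[cite: Kudla1994, §3] [cite: KudlaSweet1997, §1] -/
theorem sum_weylDelta_add_mul_comp_of_sq {κ₁ κ₂ : ℂ} (hκ : κ₂ = κ₁ ^ 2) (hμ : μ * κ₁ = -1)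
    {N₀ N₁ : Subgroup (UnitaryGroup.localPi E c (n + n) JD v)} [Fintype (N₁ ⧸ N₀.subgroupOf N₁)]
    (hFinv : ∀ h, ∀ u ∈ N₀, F₀ (h * u) = F₀ h)
    (hword : ∀ u, F₀ (θ (weylDelta F E c v n hJD * u)) = κ₂ * F₀ (weylDelta F E c v n hJD * θ u))
    (h₀ : ∀ u ∈ N₁, (θ u ∈ N₀ ↔ u ∈ N₀)) (h₁ : ∀ u ∈ N₁, θ u ∈ N₁) :
    ∑ q : N₁ ⧸ N₀.subgroupOf N₁, (fun x => F₀ x + μ * F₀ (θ x)) (weylDelta F E c v n hJD * (q.out : UnitaryGroup.localPi E c (n + n) JD v)) =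
      (1 - κ₁) * ∑ q : N₁ ⧸ N₀.subgroupOf N₁, F₀ (weylDelta F E c v n hJD * (q.out : UnitaryGroup.localPi E c (n + n) JD v)) := by
  rw [sum_weylDelta_add_mul_comp F E c v n hJD θ F₀ μ hFinv hword h₀ h₁, hκ, pow_two, ← mul_assoc, hμ]
  ring

end Witness

/-! ## §3 `θ = Ad(d_a)`: `N_Δ` and the coordinate subgroups are `Ad(d_a)`-stable; the rank relation `χ_s(ℓ_a) = χ_s(ℓ₁)^n` -/

section Similitude

variable (F : Type) [Field F] [NumberField F] (E : Type) [Field E] [NumberField E] [Algebra F E] [Algebra.IsQuadraticExtension F E]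
  (c : E ≃ₐ[F] E) {δ : E} (hcδ : c δ = -δ) (hδ : δ ≠ 0) {d : F} (hd : δ * δ = algebraMap F E d)
  (v : HeightOneSpectrum (𝓞 F)) (n : ℕ) {T₀ : Matrix (Fin n) (Fin n) F} (hT₀ : T₀.IsSymm)
  {JD : Matrix (Fin (n + n)) (Fin (n + n)) E} (hJD : JD = (gramD F n T₀).map (algebraMap F E))
  (χv : ∀ w : PlacesOver E v, (w.1.adicCompletion E)ˣ →* ℂˣ) (s : ℂ)
  (a : Fˣ) {D₀ : GL (Fin (n + n)) F}
  (hD₀ : (D₀ : Matrix (Fin (n + n)) (Fin (n + n)) F) =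
    Matrix.reindex (e₂ n) (e₂ n) (cayR F (Fin n) * Matrix.fromBlocks 1 0 0 ((a : F) • (1 : Matrix (Fin n) (Fin n) F)) * cayRinv F (Fin n)))
  {DA : GL (Fin (n + n)) E} (hDA : DA = Matrix.GeneralLinearGroup.map (algebraMap F E) D₀)
  {b : E} (hb : b ≠ 0) (hDAJ : formCongr (c : E →+* E) DA (b • JD) = JD)

omit [Algebra.IsQuadraticExtension F E] in
include hD₀ hDA in
/-- the `B`-block: `B(d_a u d_a⁻¹) = a⁻¹ · B(u)` (so `Ad(d_a) n(t) = n(a⁻¹ t)`). [cite: Kudla1994, §3] -/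
theorem blkB_matA_localCongr_dA (p : UnitaryGroup.localPi E c (n + n) JD v) :
    blkB (matA F E c v n (localCongr E c DA hb hDAJ v p)) = (toLocalRing E v (((a⁻¹ : Fˣ) : F) : v.adicCompletion F)) • blkB (matA F E c v n p) := by
  have h := adapt_matA_localCongr_dA F E c v n a hD₀ hDA hb hDAJ p
  rw [adapt_eq] at h
  exact (Matrix.fromBlocks_inj.1 h).2.1

omit [Algebra.IsQuadraticExtension F E] in
include hD₀ hDA in
/-- the `D`-block: `D(d_a u d_a⁻¹) = D(u)`. [cite: Kudla1994, §3] -/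
theorem blkD_matA_localCongr_dA (p : UnitaryGroup.localPi E c (n + n) JD v) :
    blkD (matA F E c v n (localCongr E c DA hb hDAJ v p)) = blkD (matA F E c v n p) := by
  have h := adapt_matA_localCongr_dA F E c v n a hD₀ hDA hb hDAJ p
  rw [adapt_eq] at h
  exact (Matrix.fromBlocks_inj.1 h).2.2.2

omit [Algebra.IsQuadraticExtension F E] in
include hD₀ hDA in
/-- **`N_Δ` IS `Ad(d_a)`-STABLE**: `d_a u d_a⁻¹ ∈ N_Δ ↔ u ∈ N_Δ` (`N_Δ = {C = 0, A = D = 1}`, and `Ad(d_a)` rescales only `B`, `C` by the units `a⁻¹`, `a`).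
[cite: Kudla1994, §3] [cite: HarrisKudlaSweet1996, §1 (1.11)] -/
theorem localCongr_dA_mem_unipDeltaLocal_iff (u : UnitaryGroup.localPi E c (n + n) JD v) :
    localCongr E c DA hb hDAJ v u ∈ unipDeltaLocal F E c v n (JD := JD) ↔ u ∈ unipDeltaLocal F E c v n (JD := JD) := by
  rw [mem_unipDeltaLocal_iff_blocks, mem_unipDeltaLocal_iff_blocks, blkC_matA_localCongr_dA F E c v n a hD₀ hDA hb hDAJ,
    blkA_matA_localCongr_dA F E c v n a hD₀ hDA hb hDAJ, blkD_matA_localCongr_dA F E c v n a hD₀ hDA hb hDAJ,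
    (isUnit_toLocalRing_coe F E v a).smul_eq_zero]

omit [Algebra.IsQuadraticExtension F E] in
include hD₀ hDA in
/-- **THE COORDINATE SUBGROUPS ARE `Ad(d_a)`-STABLE FOR `a⁻¹`-STABLE BOXES**: for `N_Λ = {u ∈ N_Δ : B(u) ∈ Λ}` (★ F3e `exists_coordinateSubgroup`) and a box with
`a⁻¹Λ = Λ` (e.g. any `𝒪`-submodule box and `a ∈ 𝒪_vˣ`): `d_a u d_a⁻¹ ∈ N_Λ ↔ u ∈ N_Λ`. [cite: Kudla1994, §3] [cite: KudlaSweet1997, §1] -/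
theorem localCongr_dA_mem_coordinate_iff {N : Subgroup (UnitaryGroup.localPi E c (n + n) JD v)} {Λ : Set (Matrix (Fin n) (Fin n) (LocalRing E v))}
    (hN : ∀ u, u ∈ N ↔ u ∈ unipDeltaLocal F E c v n (JD := JD) ∧ blkB (matA F E c v n u) ∈ Λ)
    (hΛ : ∀ B, (toLocalRing E v (((a⁻¹ : Fˣ) : F) : v.adicCompletion F)) • B ∈ Λ ↔ B ∈ Λ) (u : UnitaryGroup.localPi E c (n + n) JD v) :
    localCongr E c DA hb hDAJ v u ∈ N ↔ u ∈ N := by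
  rw [hN, hN, localCongr_dA_mem_unipDeltaLocal_iff F E c v n a hD₀ hDA hb hDAJ, blkB_matA_localCongr_dA F E c v n a hD₀ hDA hb hDAJ, hΛ]

omit [Algebra.IsQuadraticExtension F E] in
/-- **SIEGEL CHARACTERS UNDER A POWER RELATION OF `det_Δ`**: if `det_Δ(p)_w = (det_Δ(q)_w)^m` at every `w ∣ v` with `det_Δ(q)_w ≠ 0`, then
`χ_v(det_Δ p)|det_Δ p|^{s+n∕2} = (χ_v(det_Δ q)|det_Δ q|^{s+n∕2})^m`. [cite: HarrisKudlaSweet1996, §1 (1.15)] -/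
theorem localSiegelCharacter_eq_pow_of_detDelta {p q : UnitaryGroup.localPi E c (n + n) JD v} {m : ℕ}
    (hq : ∀ w, IsUnit (detDelta F E c v n w q)) (h : ∀ w, detDelta F E c v n w p = detDelta F E c v n w q ^ m) :
    localSiegelCharacter F E c v n χv s p = localSiegelCharacter F E c v n χv s q ^ m := by
  classical
  have hχ : chiDet F E c v n χv p = chiDet F E c v n χv q ^ m := by
    unfold chiDet
    rw [← Finset.prod_pow]
    refine Finset.prod_congr rfl fun w _ => ?_
    have hu : IsUnit (detDelta F E c v n w p) := by rw [h w]; exact (hq w).pow m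
    rw [dif_pos hu, dif_pos (hq w), ← map_pow]
    congr 1
    ext
    rw [IsUnit.unit_spec, Units.val_pow_eq_pow_val, IsUnit.unit_spec, h w]
  have hr : absDetDelta F E c v n p = absDetDelta F E c v n q ^ m := by
    unfold absDetDelta
    rw [← Finset.prod_pow]
    exact Finset.prod_congr rfl fun w _ => by rw [h w, norm_pow]
  have hpos : 0 < absDetDelta F E c v n q :=
    Finset.prod_pos fun w _ => norm_pos_iff.2 (hq w).ne_zero
  unfold localSiegelCharacter
  rw [hχ, hr, Units.val_pow_eq_pow_val, mul_pow]
  congr 1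
  rw [Complex.ofReal_pow, Complex.cpow_def_of_ne_zero (pow_ne_zero _ (Complex.ofReal_ne_zero.2 hpos.ne')),
    Complex.cpow_def_of_ne_zero (Complex.ofReal_ne_zero.2 hpos.ne'), ← Complex.exp_nat_mul, ← Complex.ofReal_pow,
    ← Complex.ofReal_log (pow_nonneg hpos.le _), Real.log_pow, ← Complex.ofReal_log hpos.le]
  push_cast
  ring_nf

omit [Algebra.IsQuadraticExtension F E] in
include hD₀ hDA in
/-- **THE RANK RELATION `χ_s(ℓ_a) = χ_s(ℓ₁)^n`**: for ANY `ℓ₁` with `det_Δ(ℓ₁)_w = a_w⁻¹` at every `w ∣ v` (the Levi letter of a rank-ONE Weyl word,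
`Ad(d_a) w₁ = ℓ₁ w₁`), the big-word Levi letter `ℓ_a = Ad(d_a)(w_Δ)·w_Δ` (`det_Δ(ℓ_a)_w = (a_w⁻¹)^n`, ★ `detDelta_leviOfWeyl`) has
`χ_v(det_Δ ℓ_a)|det_Δ ℓ_a|^{s+n∕2} = (χ_v(det_Δ ℓ₁)|det_Δ ℓ₁|^{s+n∕2})^n`. [cite: Kudla1994, §3] [cite: HarrisKudlaSweet1996, §1 (1.15)] -/
theorem localSiegelCharacter_leviOfWeyl_eq_pow {ℓ₁ : UnitaryGroup.localPi E c (n + n) JD v}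
    (hdet₁ : ∀ w, detDelta F E c v n w ℓ₁ = toLocalRing E v (((a⁻¹ : Fˣ) : F) : v.adicCompletion F) w) :
    localSiegelCharacter F E c v n χv s (localCongr E c DA hb hDAJ v (weylDelta F E c v n hJD) * weylDelta F E c v n hJD) =
      localSiegelCharacter F E c v n χv s ℓ₁ ^ n :=
  localSiegelCharacter_eq_pow_of_detDelta F E c v n χv s
    (fun w => by rw [hdet₁ w]; exact (isUnit_toLocalRing_coe F E v a⁻¹).map (Pi.evalRingHom _ w))
    fun w => by rw [detDelta_leviOfWeyl F E c v n hJD a hD₀ hDA hb hDAJ w, hdet₁ w]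

include hD₀ hDA in
/-- **THE BIG-CELL SUM OF THE SIMILITUDE WITNESS `f₀ = F + μ·(F ∘ Ad d_a)`**: for a Siegel section `F ∈ I_v(s, χ_v)` right-invariant under the coordinate
subgroup `N_{Λ₀}`, and `a⁻¹`-stable boxes `Λ₀`, `Λ` (so `Ad(d_a)` permutes `N_Λ ⧸ N_{Λ₀}`):
`Σ_{q ∈ N_Λ⧸N_{Λ₀}} f₀(w_Δ q̃) = (1 + μ · χ_v(det_Δ ℓ_a)|det_Δ ℓ_a|^{s+n∕2}) · Σ_q F(w_Δ q̃)`. [cite: Kudla1994, §3] [cite: KudlaSweet1997, §1] -/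
theorem sum_weylDelta_witness_localCongr_dA {F₀ : UnitaryGroup.localPi E c (n + n) JD v → ℂ}
    (hF : IsLocalSiegelSection F E c hcδ hδ hd v n hT₀ hJD χv s F₀) (μ : ℂ)
    {N₀ N₁ : Subgroup (UnitaryGroup.localPi E c (n + n) JD v)} {Λ₀ Λ : Set (Matrix (Fin n) (Fin n) (LocalRing E v))}
    (hN₀ : ∀ u, u ∈ N₀ ↔ u ∈ unipDeltaLocal F E c v n (JD := JD) ∧ blkB (matA F E c v n u) ∈ Λ₀)
    (hN₁ : ∀ u, u ∈ N₁ ↔ u ∈ unipDeltaLocal F E c v n (JD := JD) ∧ blkB (matA F E c v n u) ∈ Λ)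
    (hΛ₀ : ∀ B, (toLocalRing E v (((a⁻¹ : Fˣ) : F) : v.adicCompletion F)) • B ∈ Λ₀ ↔ B ∈ Λ₀)
    (hΛ : ∀ B, (toLocalRing E v (((a⁻¹ : Fˣ) : F) : v.adicCompletion F)) • B ∈ Λ ↔ B ∈ Λ) [Fintype (N₁ ⧸ N₀.subgroupOf N₁)]
    (hFinv : ∀ h, ∀ u ∈ N₀, F₀ (h * u) = F₀ h) :
    ∑ q : N₁ ⧸ N₀.subgroupOf N₁, (fun x => F₀ x + μ * F₀ (localCongr E c DA hb hDAJ v x))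
        (weylDelta F E c v n hJD * (q.out : UnitaryGroup.localPi E c (n + n) JD v)) =
      (1 + μ * localSiegelCharacter F E c v n χv s (localCongr E c DA hb hDAJ v (weylDelta F E c v n hJD) * weylDelta F E c v n hJD)) *
        ∑ q : N₁ ⧸ N₀.subgroupOf N₁, F₀ (weylDelta F E c v n hJD * (q.out : UnitaryGroup.localPi E c (n + n) JD v)) :=
  sum_weylDelta_add_mul_comp F E c v n hJD (localCongr E c DA hb hDAJ v).toMonoidHom F₀ μ hFinv
    (fun u => comp_localCongr_dA_apply_weylDelta_mul F E c hcδ hδ hd v n hT₀ hJD χv s a hD₀ hDA hb hDAJ hF u)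
    (fun u _ => localCongr_dA_mem_coordinate_iff F E c v n a hD₀ hDA hb hDAJ hN₀ hΛ₀ u)
    fun u hu => (localCongr_dA_mem_coordinate_iff F E c v n a hD₀ hDA hb hDAJ hN₁ hΛ u).2 hu

end Similitude

end Summit.HodgeConjecture.HodgeConjecture.Cruxes.HLiu418.K2LiuLocalSWRamifiedRelativeSign
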